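import Literature.MathematicalPhysics.QuantumFieldTheory.Z2FiniteTemperatureDeconfinement
import Literature.Probability.LatticeModels.IsingTorusPeierls
import HarnessLib

/-!
# `ℤ₂` lattice gauge theory deconfines at non-zero temperature in `2 + 1` dimensions
# (every temporal extent), by Griffiths' inequalities and Peierls' argument

Companion of `Z2FiniteTemperatureDeconfinement.lean` (Borgs–Seiler's abelian route, there carried
out for `d ≥ 3` space dimensions with the Ising infrared bound). On Borgs–Seiler's finite-temperature
lattice `ℤ_{L₀} × (ℤ/Lℤ)^d` (`Literature.Barriers.QuantumFields.FiniteTemperature`: time-like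
plaquette coupling `J_E`, space-like coupling `J_M`, Polyakov-loop two-point function
`G_L(x) = polyakovCorrelation ρ J_E J_M x`) the tree proves, for the gauge group `ℤ₂`,

* `Z2Thermal.isingTorus_le_polyakovCorrelation`: `G_L(x; J_E, J_M) ≥ ⟨σ_0σ_x⟩^{Ising}_{(ℤ/L)^d, K}`
  with `tanh K = (tanh J_E)^{L₀}` (Griffiths II in `J_M` + the exact reduction of the ultralocal
  model `J_M = 0` to the one-layer Ising model of the Polyakov loops; Borgs–Seiler §IV p. 358:
  "for abelian models this follows from Ginibre's inequalities").

For `d = 2` the one-layer model is the periodic PLANAR Ising model, which orders at low temperature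
by Peierls' argument, uniformly in the volume (`isingTorus_torusTwoPoint_ge_one_sub_exp`,
`IsingTorusPeierls.lean`: `⟨σ_0σ_x⟩_{𝕋_L;K} ≥ 1 - 512·19⁶e^{-2K}` for all `L ≥ 3`, all `x`). Hence:

* `z2_thermodynamicLimit_ge_dim2`: every thermodynamic limit `G∞` of the `ℤ₂` Polyakov
  correlation in `d = 2` satisfies `G∞(x) ≥ 1 - 512·19⁶·e^{-2K(J_E,L₀)}` for all `x ∈ ℤ²`
  (`J_E, J_M ≥ 0`);
* `z2_hasPolyakovLongRangeOrder_dim2`: `K(J_E, L₀) > log(512·19⁶)/2` ⇒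
  `HasPolyakovLongRangeOrder 2 L₀ z2Rep J_E J_M` — **`ℤ₂` lattice gauge theory in `2 + 1`
  dimensions DECONFINES at every temporal extent `L₀`** once `J_E ≥ log(512·19⁶)/2 + log(2L₀)/2 + 1`
  (`z2_hasPolyakovLongRangeOrder_dim2_of_ge`, `z2_finiteTemperatureDeconfinement_dim2`), for
  every `J_M ≥ 0`;
* all space dimensions `d ≥ 2` at once (`z2_finiteTemperatureDeconfinement_of_two_le`, combining
  with the tree's `d ≥ 3` theorem), and the barrier corollaries for every `d ≥ 2`: Polyakov
  confinement at all couplings / temperature-blind Polyakov confinement / volume-uniform clustering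
  at all couplings / temperature-blind uniform clustering are FALSE for `(ℤ₂, z2Rep)`
  (`z2_not_polyakovConfinementAtAllCouplings_of_two_le`, …).

HONEST LABEL. Borgs–Seiler treat `d ≥ 3` (their long-range-order mechanism is the infrared bound,
Lemma III.9); the planar case is the same abelian comparison closed by Peierls' theorem for the
periodic Ising model — an elementary consequence, not located in print as a separately stated
theorem (presearch 2026-08-28: corpus hybrid "Z2 lattice gauge theory three dimensions finite
temperature deconfinement Polyakov loop two-dimensional Ising Peierls" → Montvay–Münster §4 p. 296
(physics survey), Creutz, Greensite — no theorem; galaxy pdf "deconfinement|Polyakov loop" → noise).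
An abelian, `2+1`-dimensional witness: nothing here bears on `SU(N)`, on the zero-temperature theory
(the threshold grows like `log L₀`), on `BalabanLadder.IR`, or on the Yang–Mills mass gap (Clay),
which is NOT proved; in the `ym` ladder only the conditional finite-`𝕋⁴` rung `BalabanLadder.UV`
is closed.

## References

* C. Borgs, E. Seiler, Commun. Math. Phys. 91 (1983) 329–380: §II.3 (II.22)–(II.23) p. 337;
  §III.3 Lemma III.9, (III.87) p. 356; §IV pp. 357–359 (abelian models, Ginibre's inequalities;
  the remark on `d = 2`, p. 358). [BorgsSeiler1983]
* R. Peierls, Proc. Camb. Phil. Soc. 32 (1936) 477–481. [Peierls1936]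
* J. Fröhlich, E. H. Lieb, Comm. Math. Phys. 60 (1978) 233–267, §I.C Thm. 1.1, Cor. 1.2
  (Peierls contours on the torus). [FrohlichLieb1978]
-/

noncomputable section

open MeasureTheory Filter Finset
open scoped Topology
open Literature.Probability.LatticeModels Literature.MathematicalPhysics.QuantumLattice
open Literature.Barriers.QuantumFields Literature.Barriers.QuantumFields.FiniteTemperature

namespace Literature.MathematicalPhysics.QuantumFieldTheory

namespace Z2Thermal

variable {L₀ : ℕ}

/-! ### The planar case: Peierls instead of the infrared bound -/

/-- `exp(-2K) < 1/(512·19⁶)` when `K > log(512·19⁶)/2`, so that Peierls' bound is positive. [folklore] -/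
private theorem peierlsConst_mul_exp_lt_one {K : ℝ} (hK : Real.log (512 * 19 ^ 6) / 2 < K) :
    512 * 19 ^ 6 * Real.exp (-2 * K) < 1 := by
  set A : ℝ := Real.log (512 * 19 ^ 6) with hA
  have hAK : -2 * K < -A := by linarith
  have h1 : Real.exp (-2 * K) < Real.exp (-A) := Real.exp_lt_exp.2 hAK
  rw [hA, Real.exp_neg, Real.exp_log (by positivity)] at h1
  have h2 : 512 * 19 ^ 6 * Real.exp (-2 * K) < 512 * 19 ^ 6 * (512 * 19 ^ 6 : ℝ)⁻¹ :=
    mul_lt_mul_of_pos_left h1 (by positivity)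
  rwa [mul_inv_cancel₀ (by positivity)] at h2

/-- **Every thermodynamic limit of the planar `ℤ₂` Polyakov correlation is bounded below by
Peierls' bound**: in `d = 2` space dimensions, at temporal extent `L₀ ≥ 1` and couplings
`J_E, J_M ≥ 0`, every (even periodic box, subsequential) thermodynamic limit `G∞` of
`G_L(x; J_E, J_M)` satisfies `G∞(x) ≥ 1 - 512·19⁶·e^{-2K(J_E,L₀)}` for all `x ∈ ℤ²`
(`tanh K(J_E,L₀) = (tanh J_E)^{L₀}`): `G_L ≥ ⟨σ_0σ_x⟩^{Ising}_{𝕋_L,K}` (Griffiths) and Peierls'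
bound for the periodic planar Ising model, uniform in `L`.
[cite: BorgsSeiler1983, §IV (pp. 357–359)] [cite: Peierls1936] -/
theorem _root_.Literature.MathematicalPhysics.QuantumFieldTheory.z2_thermodynamicLimit_ge_dim2
    (L₀ : ℕ) [NeZero L₀] {JE JM : ℝ} (hJE : 0 ≤ JE) (hJM : 0 ≤ JM)
    {Ginf : (Fin 2 → ℤ) → ℝ} (hG : IsThermodynamicLimit (d := 2) (L₀ := L₀) z2Rep JE JM Ginf)
    (x : Fin 2 → ℤ) :
    1 - 512 * 19 ^ 6 * Real.exp (-2 * effCoupling JE L₀) ≤ Ginf x := by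
  obtain ⟨φ, hφ, hlim⟩ := hG
  have hK0 : 0 ≤ effCoupling JE L₀ := by
    rcases hJE.eq_or_lt with h | h
    · rw [← h, effCoupling, Real.tanh_zero, zero_pow (NeZero.ne L₀), Real.artanh_zero]
    · exact (effCoupling_pos h).le
  have hev : ∀ᶠ n : ℕ in atTop, 1 ≤ φ n :=
    eventually_atTop.2 ⟨1, fun n hn => hn.trans (hφ.id_le n)⟩
  refine ge_of_tendsto (hlim x) ?_
  filter_upwards [hev] with n hn
  haveI : NeZero (2 * φ n + 2) := ⟨by omega⟩
  calc 1 - 512 * 19 ^ 6 * Real.exp (-2 * effCoupling JE L₀)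
      ≤ torusTwoPoint (isingTorusMeasure 2 (2 * φ n + 2) (effCoupling JE L₀) 0)
          (fun i => ((x i : ℤ) : ZMod (2 * φ n + 2))) :=
        isingTorus_torusTwoPoint_ge_one_sub_exp (by omega) hK0 _
    _ ≤ polyakovCorrelation (L₀ := L₀) z2Rep JE JM (fun i => ((x i : ℤ) : ZMod (2 * φ n + 2))) :=
        isingTorus_le_polyakovCorrelation (by omega) hJE hJM _

/-- **Deconfinement of planar `ℤ₂` lattice gauge theory at every temporal extent**: in `d = 2`
space dimensions, at temporal extent `L₀ ≥ 1`, for `J_E ≥ 0` with `K(J_E, L₀) > log(512·19⁶)/2`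
and every `J_M ≥ 0`, the Polyakov loops have long-range order
(`FiniteTemperature.HasPolyakovLongRangeOrder`): every thermodynamic limit is bounded below by the
positive constant `1 - 512·19⁶e^{-2K}` on all of `ℤ²`, so it does not tend to `0` at infinity.
(Borgs–Seiler's abelian route with Peierls' theorem in place of the infrared bound, which is not
available in the plane.) [cite: BorgsSeiler1983, §IV (pp. 357–359)] [cite: Peierls1936] -/
theorem _root_.Literature.MathematicalPhysics.QuantumFieldTheory.z2_hasPolyakovLongRangeOrder_dim2
    (L₀ : ℕ) [NeZero L₀] {JE JM : ℝ} (hJE : 0 ≤ JE) (hJM : 0 ≤ JM)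
    (hK : Real.log (512 * 19 ^ 6) / 2 < effCoupling JE L₀) :
    HasPolyakovLongRangeOrder 2 L₀ z2Rep JE JM := by
  intro Ginf hG hzero
  set c : ℝ := 1 - 512 * 19 ^ 6 * Real.exp (-2 * effCoupling JE L₀) with hc
  have hcpos : 0 < c := by
    have := peierlsConst_mul_exp_lt_one hK
    rw [hc]; linarith
  have hge : ∀ x : Fin 2 → ℤ, c ≤ Ginf x := fun x => z2_thermodynamicLimit_ge_dim2 L₀ hJE hJM hG x
  have hlt : ∀ᶠ x in cofinite, Ginf x < c := (tendsto_order.1 hzero).2 c hcpos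
  have hfin : {x : Fin 2 → ℤ | ¬ Ginf x < c}.Finite := Filter.eventually_cofinite.1 hlt
  have huniv : {x : Fin 2 → ℤ | ¬ Ginf x < c} = Set.univ :=
    Set.eq_univ_of_forall fun x => not_lt.2 (hge x)
  rw [huniv] at hfin
  exact Set.infinite_univ hfin

/-! #### An explicit threshold in `J_E` -/

/-- `1 - tanh J ≤ 2 e^{-2J}`. [folklore] -/
private theorem one_sub_tanh_le (J : ℝ) : 1 - Real.tanh J ≤ 2 * Real.exp (-2 * J) := by
  rw [Real.tanh_eq]
  have hp : 0 < Real.exp J + Real.exp (-J) := by positivity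
  have key : 1 - (Real.exp J - Real.exp (-J)) / (Real.exp J + Real.exp (-J)) =
      2 * Real.exp (-J) / (Real.exp J + Real.exp (-J)) := by
    field_simp
    ring
  rw [key, div_le_iff₀ hp]
  have h2 : Real.exp (-2 * J) * Real.exp J = Real.exp (-J) := by
    rw [← Real.exp_add]; congr 1; ring
  nlinarith [Real.exp_pos J, Real.exp_pos (-J), Real.exp_pos (-2 * J), h2,
    mul_pos (Real.exp_pos (-2 * J)) (Real.exp_pos (-J))]

/-- **Explicit lower bound for the effective coupling**: for `J_E ≥ 1`,
`K(J_E, L₀) ≥ J_E - log(2L₀)/2` (from `1 - (tanh J_E)^{L₀} ≤ L₀(1 - tanh J_E) ≤ 2L₀e^{-2J_E}` and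
`artanh a = ½ log((1+a)/(1-a)) ≥ ½ log(1/(1-a))`); the computation of the companion file, repeated
here because it is private there. [folklore] -/
private theorem effCoupling_ge' [NeZero L₀] {JE : ℝ} (hJE : 1 ≤ JE) :
    JE - Real.log (2 * L₀) / 2 ≤ effCoupling JE L₀ := by
  set t : ℝ := Real.tanh JE with ht
  set r : ℝ := Real.exp (-2 * JE) with hr
  set a : ℝ := t ^ L₀ with ha
  have hL₀ : (1 : ℝ) ≤ L₀ := by exact_mod_cast Nat.one_le_iff_ne_zero.2 (NeZero.ne L₀)
  have hr_pos : 0 < r := Real.exp_pos _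
  have hr_half : 2 * r ≤ 1 := by
    have : r ≤ Real.exp (-2) := Real.exp_le_exp.2 (by linarith)
    have h2 : Real.exp (-2) ≤ 1 / 2 := by
      have := Real.exp_one_gt_d9
      have h4 : Real.exp (-2) * Real.exp 2 = 1 := by rw [← Real.exp_add]; simp
      have h5 : Real.exp 2 = Real.exp 1 * Real.exp 1 := by rw [← Real.exp_add]; norm_num
      nlinarith [Real.exp_pos (-2), Real.exp_pos 1]
    linarith
  have ht1 : t < 1 := Real.tanh_lt_one JE
  have ht0 : 0 ≤ t := by
    rw [ht, Real.tanh_eq_sinh_div_cosh]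
    exact div_nonneg (Real.sinh_nonneg_iff.2 (by linarith)) (Real.cosh_pos _).le
  have htr : 1 - 2 * r ≤ t := by have := one_sub_tanh_le JE; rw [← ht, ← hr] at this; linarith
  have ha1 : a < 1 := by rw [ha]; exact pow_lt_one₀ ht0 ht1 (NeZero.ne L₀)
  have hbern : 1 - 2 * L₀ * r ≤ a := by
    have h1 : 1 + (L₀ : ℝ) * (-(2 * r)) ≤ (1 + -(2 * r)) ^ L₀ :=
      one_add_mul_le_pow (by linarith) L₀
    have h2 : (1 + -(2 * r)) ^ L₀ ≤ t ^ L₀ :=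
      pow_le_pow_left₀ (by linarith) (by linarith) L₀
    rw [ha]; linarith
  have h1a : 0 < 1 - a := by linarith
  have hart : effCoupling JE L₀ = 1 / 2 * Real.log ((1 + a) / (1 - a)) := by
    rw [effCoupling, ← ht, ← ha]
    exact Real.artanh_eq_half_log ⟨by linarith [pow_nonneg ht0 L₀], ha1.le⟩
  have hq : Real.exp (2 * JE) / (2 * L₀) ≤ (1 + a) / (1 - a) := by
    rw [div_le_div_iff₀ (by positivity) h1a]
    have h3 : Real.exp (2 * JE) * (1 - a) ≤ Real.exp (2 * JE) * (2 * L₀ * r) :=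
      mul_le_mul_of_nonneg_left (by linarith) (Real.exp_pos _).le
    have h4 : Real.exp (2 * JE) * (2 * L₀ * r) = 2 * L₀ := by
      rw [hr, mul_comm (2 * (L₀ : ℝ)) _, ← mul_assoc, ← Real.exp_add]; simp
    have ha0 : 0 ≤ a := by rw [ha]; exact pow_nonneg ht0 _
    nlinarith [Real.exp_pos (2 * JE)]
  have hlog : Real.log (Real.exp (2 * JE) / (2 * L₀)) ≤ Real.log ((1 + a) / (1 - a)) :=
    Real.log_le_log (by positivity) hq
  rw [Real.log_div (Real.exp_pos _).ne' (by positivity), Real.log_exp] at hlog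
  rw [hart]
  linarith

/-- **Deconfinement of planar `ℤ₂` lattice gauge theory at every temporal extent — explicit
threshold**: in `d = 2` space dimensions, at temporal extent `L₀ ≥ 1`, for every electric coupling
`J_E ≥ log(512·19⁶)/2 + log(2L₀)/2 + 1` and every magnetic coupling `J_M ≥ 0` the Polyakov loops
of the `ℤ₂` theory have long-range order (since then `K(J_E,L₀) ≥ J_E - log(2L₀)/2 > log(512·19⁶)/2`).
[cite: BorgsSeiler1983, §IV (pp. 357–359)] [cite: Peierls1936] -/
theorem _root_.Literature.MathematicalPhysics.QuantumFieldTheory.z2_hasPolyakovLongRangeOrder_dim2_of_ge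
    (L₀ : ℕ) [NeZero L₀] {JE JM : ℝ}
    (hJE : Real.log (512 * 19 ^ 6) / 2 + Real.log (2 * L₀) / 2 + 1 ≤ JE) (hJM : 0 ≤ JM) :
    HasPolyakovLongRangeOrder 2 L₀ z2Rep JE JM := by
  set A : ℝ := Real.log (512 * 19 ^ 6) with hA
  set B : ℝ := Real.log (2 * L₀) with hB
  have hlog19 : 0 ≤ A := Real.log_nonneg (by norm_num)
  have hlog : 0 ≤ B := Real.log_nonneg (by
    have : (1 : ℝ) ≤ L₀ := by exact_mod_cast Nat.one_le_iff_ne_zero.2 (NeZero.ne L₀)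
    linarith)
  have hJE1 : 1 ≤ JE := by linarith
  refine z2_hasPolyakovLongRangeOrder_dim2 L₀ (by linarith) hJM ?_
  have h := effCoupling_ge' (L₀ := L₀) hJE1
  rw [← hB] at h
  change A / 2 < effCoupling JE L₀
  linarith

/-- **Deconfinement of `ℤ₂` lattice gauge theory in `2 + 1` dimensions at every temporal extent**:
for every `L₀ ≥ 1` there is `J₀ = log(512·19⁶)/2 + log(2L₀)/2 + 1 > 0` such that for all
`J_E ≥ J₀` and all `J_M ≥ 0` the Polyakov loops of the planar `ℤ₂` theory have long-range order —
the shape of the `U(N)`/`SU(N)` named fact `FiniteTemperatureDeconfinement`, for `ℤ₂` and `d = 2`,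
PROVED. [cite: BorgsSeiler1983, §IV (pp. 357–359)] [cite: Peierls1936] -/
theorem _root_.Literature.MathematicalPhysics.QuantumFieldTheory.z2_finiteTemperatureDeconfinement_dim2
    (L₀ : ℕ) [NeZero L₀] :
    ∃ J₀ : ℝ, 0 < J₀ ∧ ∀ JE JM : ℝ, J₀ ≤ JE → 0 ≤ JM →
      HasPolyakovLongRangeOrder 2 L₀ z2Rep JE JM := by
  set A : ℝ := Real.log (512 * 19 ^ 6) with hA
  set B : ℝ := Real.log (2 * L₀) with hB
  have hlog19 : 0 ≤ A := Real.log_nonneg (by norm_num)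
  have hlog : 0 ≤ B := Real.log_nonneg (by
    have : (1 : ℝ) ≤ L₀ := by exact_mod_cast Nat.one_le_iff_ne_zero.2 (NeZero.ne L₀)
    linarith)
  exact ⟨A / 2 + B / 2 + 1, by positivity,
    fun JE JM hJE hJM => z2_hasPolyakovLongRangeOrder_dim2_of_ge L₀ hJE hJM⟩

/-! ### Every space dimension `d ≥ 2` -/

/-- **Deconfinement of `ℤ₂` lattice gauge theory at every temporal extent, in every space
dimension `d ≥ 2`**: for every `L₀ ≥ 1` there is `J₀ > 0` with
`HasPolyakovLongRangeOrder d L₀ z2Rep J_E J_M` for all `J_E ≥ J₀`, `J_M ≥ 0` (Peierls for `d = 2`,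
the infrared bound for `d ≥ 3` — the tree's `z2_finiteTemperatureDeconfinement`).
[cite: BorgsSeiler1983, §III.3 (III.87) (p. 356); §IV (pp. 357–359)] [cite: Peierls1936] -/
theorem _root_.Literature.MathematicalPhysics.QuantumFieldTheory.z2_finiteTemperatureDeconfinement_of_two_le
    {d : ℕ} (hd : 2 ≤ d) (L₀ : ℕ) [NeZero L₀] :
    ∃ J₀ : ℝ, 0 < J₀ ∧ ∀ JE JM : ℝ, J₀ ≤ JE → 0 ≤ JM →
      HasPolyakovLongRangeOrder d L₀ z2Rep JE JM := by
  rcases Nat.lt_or_ge d 3 with h | h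
  · obtain rfl : d = 2 := by omega
    exact z2_finiteTemperatureDeconfinement_dim2 L₀
  · exact z2_finiteTemperatureDeconfinement h L₀

/-! #### Barrier corollaries in every space dimension `d ≥ 2` -/

/-- **`ℤ₂`: Polyakov confinement at all couplings is FALSE at every temporal extent `L₀`, in every
space dimension `d ≥ 2`** (the tree's `z2_not_polyakovConfinementAtAllCouplings` is `d ≥ 3`).
[cite: BorgsSeiler1983, §IV (pp. 357–359)] -/
theorem _root_.Literature.MathematicalPhysics.QuantumFieldTheory.z2_not_polyakovConfinementAtAllCouplings_of_two_le
    {d : ℕ} (hd : 2 ≤ d) (L₀ : ℕ) [NeZero L₀] : ¬ PolyakovConfinementAtAllCouplings d L₀ z2Rep := by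
  intro h
  obtain ⟨J₀, hJ₀, hLRO⟩ := z2_finiteTemperatureDeconfinement_of_two_le hd L₀
  obtain ⟨Ginf, hG⟩ := exists_isThermodynamicLimit (d := d) (L₀ := L₀) z2Rep
    continuous_of_discreteTopology z2Rep_mem_unitaryGroup J₀ 1
  exact hLRO J₀ 1 le_rfl zero_le_one Ginf hG (h J₀ 1 hJ₀ one_pos Ginf hG)

/-- **`ℤ₂`: temperature-blind Polyakov confinement is FALSE in every space dimension `d ≥ 2`.**
[cite: BorgsSeiler1983, §IV (pp. 357–359)] -/
theorem _root_.Literature.MathematicalPhysics.QuantumFieldTheory.z2_not_temperatureBlindPolyakovConfinement_of_two_le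
    {d : ℕ} (hd : 2 ≤ d) : ¬ TemperatureBlindPolyakovConfinement d z2Rep :=
  fun h => z2_not_polyakovConfinementAtAllCouplings_of_two_le hd 1 (h 1)

/-- **`ℤ₂`: volume-uniform exponential clustering of the Polyakov correlation at all couplings is
FALSE at every temporal extent, in every space dimension `d ≥ 2`.**
[cite: BorgsSeiler1983, §II.4 (II.55)–(II.56) (p. 343); §IV (pp. 357–359)] -/
theorem _root_.Literature.MathematicalPhysics.QuantumFieldTheory.z2_not_uniformClusteringAtAllCouplings_of_two_le
    {d : ℕ} (hd : 2 ≤ d) (L₀ : ℕ) [NeZero L₀] : ¬ UniformClusteringAtAllCouplings d L₀ z2Rep :=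
  fun h => z2_not_polyakovConfinementAtAllCouplings_of_two_le hd L₀ h.polyakovConfinement

/-- **`ℤ₂`: temperature-blind volume-uniform clustering is FALSE in every space dimension `d ≥ 2`.**
[cite: BorgsSeiler1983, §IV (pp. 357–359)] -/
theorem _root_.Literature.MathematicalPhysics.QuantumFieldTheory.z2_not_temperatureBlindUniformClustering_of_two_le
    {d : ℕ} (hd : 2 ≤ d) : ¬ TemperatureBlindUniformClustering d z2Rep :=
  fun h => z2_not_temperatureBlindPolyakovConfinement_of_two_le hd h.polyakovConfinement

end Z2Thermal

end Literature.MathematicalPhysics.QuantumFieldTheory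

end
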